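import Mathlib
import HarnessLib

/-!
# The AMP margin `t*` of a rank-one (polar) pencil — definition with explicit hypotheses

pub-rhpf PF seat (mechanism search; **no RH claim**).  RULING A7 of the cell's adjudication log asks for a
Lean definition of the *anti-maximum-principle margin* `t*` used in `PF.md` §14 (row PF-I1), with its hypotheses
and conventions explicit.  Setting (abstract, finite- or infinite-dimensional): a real inner-product space `E`
(the Galerkin space of one window), a linear map `A₀` (the pole-free block), a vector `c` (the polar vector
`cosh(x/2)` restricted to the window), a family of evaluation maps `ev : ι → E → ℝ` (point values of the
reconstructed function on a grid, or all points of the window — no linearity is needed below), a floor `δ`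
("one-signed" := every evaluation `> δ`), the polar overlap `p = ⟪c, u⟫`, the bottom `ε₁` of the pencil
`A₀ + 2|c⟩⟨c|` and the first excited level `E₁` of `A₀`.

* `ampFailureLevels` : the levels `s ∈ [ε₁, E₁]` at which the `u`-normalised pole-free resolvent family
  `v(s)`, `A₀ v - s v = -(2p) c` (so that `v(ε₁) = u` by the eigen-equation `A₀ u + 2p c = ε₁ u`), has a member
  that is NOT one-signed above `δ`; the level `E₁` is adjoined (convention: `t* ≤ 1`).
* `ampThreshold = s* := inf ampFailureLevels`, `ampMargin = t* := (s* - ε₁)/(E₁ - ε₁)`.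

Proved (elementary order arguments, no spectral theory):
* `ampThreshold_mem_Icc` : `ε₁ ≤ s* ≤ E₁`; `ampMargin_nonneg`, `ampMargin_le_one`;
* `oneSigned_of_ampMargin_pos` : **the convention is automatic** — if `t* > 0` then `u` itself is one-signed
  above `δ` (equivalently: `u` not one-signed ⇒ `t* = 0`);
* `le_ampMargin_of_oneSigned_near` : if every solution at every level `s ∈ [ε₁, ε₁ + η)` is one-signed and
  `ε₁ + η ≤ E₁` then `η/(E₁ - ε₁) ≤ t*` (the form in which a STEP hypothesis would feed a lower bound on `t*`).

Informal anchors: Clément–Peletier anti-maximum principle; the resolvent identity `u = -2p (A₀-ε₁)⁻¹ c` is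
`polarRepresentableSeq_of_integral_cosh_ne_zero` / `rankOne_secular_identity` in the tree.  DATA (not used
here): `t* ≈ e^{-4.1 a}` for ζ, `PF.md` §14.3 (iii), §14.11.
-/

set_option linter.unusedVariables false
set_option linter.dupNamespace false

namespace Summit.RiemannHypothesis.RiemannHypothesis.Theorems.PolarPerronFrobenius

variable {E : Type*} [AddCommGroup E] [Module ℝ E] {ι : Type*}

/-- A DEFINITION (posited object, not a fact): the failure levels of the `u`-normalised pole-free resolvent
family — `s ∈ [ε₁, E₁]` carrying a solution of `A₀ v - s • v = -(2p) • c` that is not one-signed above the floor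
`δ`; `E₁` adjoined. [folklore] -/
def ampFailureLevels (A₀ : E →ₗ[ℝ] E) (c : E) (ev : ι → E → ℝ) (δ p ε₁ E₁ : ℝ) : Set ℝ :=
  {s | ε₁ ≤ s ∧ s ≤ E₁ ∧ ∃ v : E, A₀ v - s • v = -((2 * p) • c) ∧ ¬ (∀ i, δ < ev i v)} ∪ {E₁}

/-- A DEFINITION (posited object, not a fact): the AMP threshold `s* = inf ampFailureLevels`. [folklore] -/
noncomputable def ampThreshold (A₀ : E →ₗ[ℝ] E) (c : E) (ev : ι → E → ℝ) (δ p ε₁ E₁ : ℝ) : ℝ :=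
  sInf (ampFailureLevels A₀ c ev δ p ε₁ E₁)

/-- A DEFINITION (posited object, not a fact): the AMP margin `t* = (s* - ε₁)/(E₁ - ε₁)`. [folklore] -/
noncomputable def ampMargin (A₀ : E →ₗ[ℝ] E) (c : E) (ev : ι → E → ℝ) (δ p ε₁ E₁ : ℝ) : ℝ :=
  (ampThreshold A₀ c ev δ p ε₁ E₁ - ε₁) / (E₁ - ε₁)

section
variable (A₀ : E →ₗ[ℝ] E) (c : E) (ev : ι → E → ℝ) (δ p ε₁ E₁ : ℝ)

/-- The adjoined top level `E₁` is a failure level (convention `t* ≤ 1`). -/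
theorem mem_ampFailureLevels_top : E₁ ∈ ampFailureLevels A₀ c ev δ p ε₁ E₁ :=
  Or.inr rfl

/-- Every failure level is `≥ ε₁` (given `ε₁ ≤ E₁`). -/
theorem le_of_mem_ampFailureLevels (h : ε₁ ≤ E₁) {s : ℝ}
    (hs : s ∈ ampFailureLevels A₀ c ev δ p ε₁ E₁) : ε₁ ≤ s := by
  rcases hs with hs | hs
  · exact hs.1
  · rw [Set.mem_singleton_iff] at hs
    rw [hs]; exact h

/-- The failure levels are bounded below (by `ε₁`). -/
theorem ampFailureLevels_bddBelow (h : ε₁ ≤ E₁) : BddBelow (ampFailureLevels A₀ c ev δ p ε₁ E₁) :=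
  ⟨ε₁, fun _ hs => le_of_mem_ampFailureLevels A₀ c ev δ p ε₁ E₁ h hs⟩

/-- The failure levels are nonempty (`E₁` is adjoined). -/
theorem ampFailureLevels_nonempty : (ampFailureLevels A₀ c ev δ p ε₁ E₁).Nonempty :=
  ⟨E₁, mem_ampFailureLevels_top A₀ c ev δ p ε₁ E₁⟩

/-- `ε₁ ≤ s* ≤ E₁`. -/
theorem ampThreshold_mem_Icc (h : ε₁ ≤ E₁) :
    ampThreshold A₀ c ev δ p ε₁ E₁ ∈ Set.Icc ε₁ E₁ := by
  refine ⟨le_csInf (ampFailureLevels_nonempty A₀ c ev δ p ε₁ E₁)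
      (fun s hs => le_of_mem_ampFailureLevels A₀ c ev δ p ε₁ E₁ h hs), ?_⟩
  exact csInf_le (ampFailureLevels_bddBelow A₀ c ev δ p ε₁ E₁ h)
    (mem_ampFailureLevels_top A₀ c ev δ p ε₁ E₁)

/-- `0 ≤ t*`. -/
theorem ampMargin_nonneg (h : ε₁ < E₁) : 0 ≤ ampMargin A₀ c ev δ p ε₁ E₁ := by
  unfold ampMargin
  have h1 := (ampThreshold_mem_Icc A₀ c ev δ p ε₁ E₁ h.le).1
  exact div_nonneg (by linarith) (by linarith)

/-- `t* ≤ 1`. -/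
theorem ampMargin_le_one (h : ε₁ < E₁) : ampMargin A₀ c ev δ p ε₁ E₁ ≤ 1 := by
  unfold ampMargin
  have h2 := (ampThreshold_mem_Icc A₀ c ev δ p ε₁ E₁ h.le).2
  rw [div_le_one (by linarith)]
  linarith

/-- THE CONVENTION IS AUTOMATIC: if the pencil ground state `u` (eigen-equation `A₀ u + 2p c = ε₁ u`, written as
`A₀ u - ε₁ u = -(2p) c`) is not one-signed above `δ`, then `ε₁` is itself a failure level, so `s* = ε₁` and
`t* = 0`; contrapositively, `t* > 0` forces `u` to be one-signed. -/
theorem oneSigned_of_ampMargin_pos (h : ε₁ < E₁) {u : E}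
    (hu : A₀ u - ε₁ • u = -((2 * p) • c))
    (ht : 0 < ampMargin A₀ c ev δ p ε₁ E₁) : ∀ i, δ < ev i u := by
  by_contra hnot
  have hmem : ε₁ ∈ ampFailureLevels A₀ c ev δ p ε₁ E₁ :=
    Or.inl ⟨le_rfl, h.le, u, hu, hnot⟩
  have hle : ampThreshold A₀ c ev δ p ε₁ E₁ ≤ ε₁ :=
    csInf_le (ampFailureLevels_bddBelow A₀ c ev δ p ε₁ E₁ h.le) hmem
  have : ampMargin A₀ c ev δ p ε₁ E₁ ≤ 0 := by
    unfold ampMargin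
    exact div_nonpos_of_nonpos_of_nonneg (by linarith) (by linarith)
  linarith

/-- `u` not one-signed ⇒ `t* = 0`. -/
theorem ampMargin_eq_zero_of_not_oneSigned (h : ε₁ < E₁) {u : E}
    (hu : A₀ u - ε₁ • u = -((2 * p) • c)) (hnot : ¬ ∀ i, δ < ev i u) :
    ampMargin A₀ c ev δ p ε₁ E₁ = 0 := by
  rcases (ampMargin_nonneg A₀ c ev δ p ε₁ E₁ h).eq_or_lt with h0 | hpos
  · exact h0.symm
  · exact absurd (oneSigned_of_ampMargin_pos A₀ c ev δ p ε₁ E₁ h hu hpos) hnot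

/-- LOWER BOUND FORM: if no failure level lies in `[ε₁, ε₁ + η)` (every solution at every such level is
one-signed above `δ`) and `ε₁ + η ≤ E₁`, then `η/(E₁ - ε₁) ≤ t*`.  This is the shape in which a STEP hypothesis
(robust one-signedness of the resolvent family over a range of levels) yields a margin. -/
theorem le_ampMargin_of_oneSigned_near (h : ε₁ < E₁) {η : ℝ} (hη : ε₁ + η ≤ E₁)
    (hone : ∀ s, ε₁ ≤ s → s < ε₁ + η → ∀ v : E, A₀ v - s • v = -((2 * p) • c) → ∀ i, δ < ev i v) :
    η / (E₁ - ε₁) ≤ ampMargin A₀ c ev δ p ε₁ E₁ := by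
  have hs : ε₁ + η ≤ ampThreshold A₀ c ev δ p ε₁ E₁ := by
    refine le_csInf (ampFailureLevels_nonempty A₀ c ev δ p ε₁ E₁) (fun s hs => ?_)
    rcases hs with ⟨h1, h2, v, hv, hnot⟩ | hs
    · by_contra hlt
      exact hnot (hone s h1 (lt_of_not_ge hlt) v hv)
    · rw [Set.mem_singleton_iff] at hs
      rw [hs]; exact hη
  unfold ampMargin
  rw [div_le_div_iff_of_pos_right (by linarith)]
  linarith

end

end Summit.RiemannHypothesis.RiemannHypothesis.Theorems.PolarPerronFrobenius
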